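/-
Copyright (c) 2026 the pub-hodgecm-mathlib formalisation cell (harness21).  Prover seat hodgecm-mathlib-LH4-p12 (g7), req620 Track A «(D-RAM) FOUR-FRAME», line LH4
(STAGE-1b tier-0 regular row, (L-sq) labelled trunk brick (d) PART 2: the glued cells G1 ∕ G2 of the labelled trunk IN THE CURRENCY OF `SqLabelledBoxSum` — tube untouched,
glue foot truncated by `2ρ + m* ≤ 2·n_plane`, empty strata off the windows).  2026-09-04.
-/
import Summits.HodgeConjecture.HodgeConjecture.Theorems.F0P3cDyRamSqLabelledCellsSplit              -- (d) PART 1 (this seat): the token letters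
import Summits.HodgeConjecture.HodgeConjecture.Theorems.F0P3cDyRamLabelledKappaGluedSocketsNotCut    -- ★ p859941 (this seat): G1∕H∕G2∕G3 sockets off the class cut; brings ★ p859787 rotations
import Summits.HodgeConjecture.HodgeConjecture.Theorems.F0P3cDyRamStableCountTypeZero               -- ★ `finite_normalisedStableLattices`, `v_diag_eq_one`, `diag_regular`
import Summits.HodgeConjecture.HodgeConjecture.Theorems.F0P3cDyRamDiagonalOrbitAveraging             -- ★ `relIndex_fixedUnitStabilizer_ne_zero_of_finite`
import Summits.HodgeConjecture.HodgeConjecture.Theorems.F0P3cDyRamDiagonalOrbitFibreCountHeads       -- ★ `finite_unitTorus_orbit_of_mem_normalisedStableLattices`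
import Summits.HodgeConjecture.HodgeConjecture.Theorems.F0P3cDyRamSqDatumDerivedFence              -- ★ p859917 (this seat): `lt_of_pow_lt_pow`
import HarnessLib

/-!
# Crux `H413`, line LH4 «(D-RAM) FOUR-FRAME» — (d) PART 2: THE GLUED CELLS G1 ∕ G2 OF THE SQUARE LABEL IN BOX-SUM CURRENCY

For the square label of record `Q = LatticeInLevel ϖ ℓ (diag e)`, `e = ((α−1)², (β−1)², 0)`, `ℓ + 1 = d % 2 + 2d`, under the fence `2d ≤ nᵢ + 1` (★ p859917), the labelled
κ-cell of the glued stratum `G1(ρ,s) = (2ρ, 2ρ+s, 2ρ+s)` equals ★ p856906's `hG1` value with the glue-FOOT summand cut by `2ρ + (d%2 + 2d) ≤ 2n₂ + 1` — the `hG1` letter of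
`SqLabelledBoxSum` (LH4-p12 DEFS, ★ p859958) token for token; likewise G2 by the ★ p859787 rotation.  Three regimes: a WINDOW holds (tube or foot) ⇒ the cell is off the class
cut (★ p859941 `_of_not_cut`: `a ≠ b`, or `a = b` but vacuous) and the label indicator is evaluated from the token letters (PART 1 §1) by exponent arithmetic; NO window ⇒ the
stratum is EMPTY (the ★ stable socket vanishes and stabiliser weights are positive on `𝓛₀(T)`), so the labelled cell is `0` for ANY label (and this transports to G2∕G3 by rotation).

* §1 `stratum_eq_empty_of_finsum_stabiliserWeight_eq_zero`, `stratum_G1_eq_empty_of_no_window`, `cellAny_G1∕G2∕G3_of_no_window` (any label vector).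
* §2 `sqLabel_G1_cond_of`, `le_of_sqLabel_G1_cond` — the G1 label condition from ∕ to exponent inequalities.
* §3 `cell_G1`, `cell_G2` — the glued cells in box-sum currency.

HONEST LABEL: helper lane (`--supports stmt-HodgeConjecture-24833`), count-neutral; per-stratum census identities; pays no tier-0 row (T₊∕T₋∕reg OPEN; labelled trunk OPEN =
(c) `SqLabelledBoxSum_holds` (LH4-p10) + (d) PARTS 3–4); HC_CM is proved only modulo the 7 printed citations (2 remaining named inputs: hLiu418 = stmt-HodgeConjecture-24832,
h413 = stmt-HodgeConjecture-24833) until rung 0 closes.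

## References (NEVER `[KR2]`)
* [Kottwitz1986BaseChangeUnits] R. E. Kottwitz, *Base change for unit elements of Hecke algebras*, Compositio Math. 60 (1986), §1 pp. 240–241.
* [Rogawski1990] J. D. Rogawski, *Automorphic Representations of Unitary Groups in Three Variables*, Ann. of Math. Stud. 123 (1990), §4.9 Prop. 4.9.1 (a) p. 55, §4.10 p. 58.
* [LanglandsShelstad1987] R. P. Langlands, D. Shelstad, *On the definition of transfer factors*, Math. Ann. 278 (1987), §3.
-/

set_option autoImplicit false

noncomputable section

namespace Summit.HodgeConjecture.HodgeConjecture.Cruxes.H413.F0P3cDyRamSqLabelledCellsGlued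

open Matrix
open Literature.NumberTheory.Automorphic Literature.NumberTheory.Automorphic.HermitianLattice
open Literature.NumberTheory.Automorphic.UnitaryLatticeTree Literature.NumberTheory.Automorphic.UnitaryThreeFourFrame
open Literature.NumberTheory.LocalFields Literature.NumberTheory.LocalFields.WildQuadraticDatum
open Summit.HodgeConjecture.HodgeConjecture.Cruxes.H413.F0P3cDyRamDiagonalTorusDefs
open Summit.HodgeConjecture.HodgeConjecture.Cruxes.H413.F0P3cDyRamDiagonalStrataDefs
open Summit.HodgeConjecture.HodgeConjecture.Cruxes.H413.F0P3cDyRamDiagonalKappaCountDefs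
open Summit.HodgeConjecture.HodgeConjecture.Cruxes.H413.F0P3cDyRamDiagonalOrbitAveraging (relIndex_fixedUnitStabilizer_ne_zero_of_finite)
open Summit.HodgeConjecture.HodgeConjecture.Cruxes.H413.F0P3cDyRamDiagonalOrbitFibreCountHeads (finite_unitTorus_orbit_of_mem_normalisedStableLattices)
open Summit.HodgeConjecture.HodgeConjecture.Cruxes.H413.F0P3cDyRamDiagonalGluedSocket (finsum_stabiliserWeight_hasAxis_G1)
open Summit.HodgeConjecture.HodgeConjecture.Cruxes.H413.F0P3cDyRamDiagonalKappaGluedRotations (vec3_swap01 vec3_swap02)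
open Summit.HodgeConjecture.HodgeConjecture.Cruxes.H413.F0P3cDyRamStableCountTypeZero (finite_normalisedStableLattices v_diag_eq_one diag_regular)
open Summit.HodgeConjecture.HodgeConjecture.Cruxes.H413.F0P3cDyRamElementDatumParity (isoceles_of_isElementDatum depth_mod_two_eq_of_isElementDatum)
open Summit.HodgeConjecture.HodgeConjecture.Cruxes.H413.F0P3cDyRamFourFrameCensusDefs
open Summit.HodgeConjecture.HodgeConjecture.Cruxes.H413.F0P3cDyRamSqDatumDerivedFence (lt_of_pow_lt_pow)
open Summit.HodgeConjecture.HodgeConjecture.Cruxes.H413.F0P3cDyRamLabelledKappaStrataPermutation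
open Summit.HodgeConjecture.HodgeConjecture.Cruxes.H413.F0P3cDyRamLabelledKappaGluedSocketsNotCut
open Summit.HodgeConjecture.HodgeConjecture.Cruxes.H413.F0P3cDyRamSqLabelledCellsSplit
open scoped Valued WithZero Matrix MatrixGroups

variable {K : Type} [Field K] [Valued K ℤᵐ⁰] [Fintype 𝓀[K]] [CompleteSpace K] {σ : K →+* K} {ϖ : K} {d t : ℕ} {α β : K} {N₀ n₁ n₂ n₃ : ℕ}
  {T : GL (Fin 3) K}

/-! ## §1  Empty strata off the windows (any label) -/

omit [CompleteSpace K] in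
/-- **A STRATUM WHOSE STABLE CENSUS VANISHES IS EMPTY**: on `𝓛₀(T)` (regular unit diagonal `T`, finite residue field) every stabiliser weight is positive (finite unit-torus orbits,
★ `relIndex_fixedUnitStabilizer_ne_zero_of_finite`), and a stratum is a finite subset of `𝓛₀(T)`. [cite: Kottwitz1986BaseChangeUnits, §1 pp. 240–241] -/
theorem stratum_eq_empty_of_finsum_stabiliserWeight_eq_zero (hD : IsRamifiedQuadraticDatum σ ϖ d t) (hE : IsElementDatum σ ϖ N₀ α β n₁ n₂ n₃)
    (hT : (T : Matrix (Fin 3) (Fin 3) K) = Matrix.diagonal ![α, β, 1]) (a : Fin 3 → ℕ)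
    (h0 : ∑ᶠ M ∈ stratum σ ϖ T a, stabiliserWeight σ M = 0) : stratum σ ϖ T a = ∅ := by
  classical
  have hvσ : ∀ x, Valued.v (σ x) = Valued.v x := hD.2.1
  have hϖ : Valued.v ϖ = WithZero.exp (-1 : ℤ) := hD.2.2.1
  have hS : (stratum σ ϖ T a).Finite := (finite_normalisedStableLattices hD hE T hT).subset fun M hM => hM.1
  by_contra hne
  obtain ⟨M, hM⟩ := Set.nonempty_iff_ne_empty.2 hne
  have hpos : ∀ M' ∈ hS.toFinset, 0 < stabiliserWeight σ M' := fun M' hM' => by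
    have hM'' : M' ∈ normalisedStableLattices T := (hS.mem_toFinset.1 hM').1
    have hn := relIndex_fixedUnitStabilizer_ne_zero_of_finite σ
      (finite_unitTorus_orbit_of_mem_normalisedStableLattices hϖ (v_diag_eq_one hvσ hE) (diag_regular hE) T hT hM'')
    unfold stabiliserWeight
    exact inv_pos.2 (Nat.cast_pos.2 (Nat.pos_of_ne_zero hn))
  rw [finsum_mem_eq_finite_toFinset_sum _ hS] at h0
  have hlt : 0 < ∑ M' ∈ hS.toFinset, stabiliserWeight σ M' := Finset.sum_pos hpos ⟨M, hS.mem_toFinset.2 hM⟩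
  exact absurd h0 hlt.ne'

omit [CompleteSpace K] in
/-- **THE GLUED STRATUM G1 IS EMPTY OFF THE WINDOWS**: if neither the tube window `2∣s ∧ 2ρ ≤ min n₂ n₃ ∧ 2ρ + s ≤ n₁` nor the glue-foot window
`2∣s ∧ n₂ = n₃ ∧ n₁ = n₂ + s ∧ n₂ < 2ρ ∧ 2ρ − n₂ ≤ n₂ − d + 1` holds, `stratum(2ρ, 2ρ+s, 2ρ+s) = ∅` (★ stable socket `finsum_stabiliserWeight_hasAxis_G1` vanishes).
[cite: Kottwitz1986BaseChangeUnits, §1 pp. 240–241] [cite: Rogawski1990, §4.9 Prop. 4.9.1 (a) p. 55] -/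
theorem stratum_G1_eq_empty_of_no_window (hD : IsRamifiedQuadraticDatum σ ϖ d t) (h2 : Valued.v (2 : K) < 1) (hE : IsElementDatum σ ϖ N₀ α β n₁ n₂ n₃)
    (hN₀ : d ≤ N₀) (hT : (T : Matrix (Fin 3) (Fin 3) K) = Matrix.diagonal ![α, β, 1]) (ρ s : ℕ) (hρ : 1 ≤ ρ) (hs : 1 ≤ s)
    (hnot : ¬ (2 ∣ s ∧ 2 * ρ ≤ min n₂ n₃ ∧ 2 * ρ + s ≤ n₁)) (hnof : ¬ (2 ∣ s ∧ n₂ = n₃ ∧ n₁ = n₂ + s ∧ n₂ < 2 * ρ ∧ 2 * ρ - n₂ ≤ n₂ - d + 1)) :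
    stratum σ ϖ T ![2 * ρ, 2 * ρ + s, 2 * ρ + s] = ∅ := by
  refine stratum_eq_empty_of_finsum_stabiliserWeight_eq_zero hD hE hT _ ?_
  rw [finsum_stabiliserWeight_hasAxis_G1 hD h2 hE hN₀ hT ρ s hρ hs, if_neg hnot, if_neg hnof, add_zero]

omit [CompleteSpace K] in
/-- **ANY-LABEL G1 CELL OFF THE WINDOWS**: `0` (the stratum is empty). [cite: Kottwitz1986BaseChangeUnits, §1 pp. 240–241] -/
theorem cellAny_G1_of_no_window (hD : IsRamifiedQuadraticDatum σ ϖ d t) (h2 : Valued.v (2 : K) < 1) (hE : IsElementDatum σ ϖ N₀ α β n₁ n₂ n₃)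
    (hN₀ : d ≤ N₀) (hT : (T : Matrix (Fin 3) (Fin 3) K) = Matrix.diagonal ![α, β, 1]) (ρ s : ℕ) (hρ : 1 ≤ ρ) (hs : 1 ≤ s) (i : Fin 3) (ℓ : ℕ) (e : Fin 3 → K)
    (hnot : ¬ (2 ∣ s ∧ 2 * ρ ≤ min n₂ n₃ ∧ 2 * ρ + s ≤ n₁)) (hnof : ¬ (2 ∣ s ∧ n₂ = n₃ ∧ n₁ = n₂ + s ∧ n₂ < 2 * ρ ∧ 2 * ρ - n₂ ≤ n₂ - d + 1)) :
    ∑ᶠ M ∈ {M | M ∈ stratum σ ϖ T ![2 * ρ, 2 * ρ + s, 2 * ρ + s] ∧ LatticeInLevel ϖ ℓ (Matrix.diagonal e) M},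
      (kappaCount σ ϖ 0 i M : ℚ) * stabiliserWeight σ M = 0 := by
  rw [stratum_G1_eq_empty_of_no_window hD h2 hE hN₀ hT ρ s hρ hs hnot hnof]
  simp

omit [CompleteSpace K] in
/-- **ANY-LABEL G2 CELL OFF THE (SWAPPED) WINDOWS**: `0` — ★ p859787 rotation of the previous lemma (datum `(β, α; n₂, n₁, n₃)`). [cite: Kottwitz1986BaseChangeUnits, §1 pp. 240–241] -/
theorem cellAny_G2_of_no_window (hD : IsRamifiedQuadraticDatum σ ϖ d t) (h2 : Valued.v (2 : K) < 1) (hE : IsElementDatum σ ϖ N₀ α β n₁ n₂ n₃)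
    (hN₀ : d ≤ N₀) (hT : (T : Matrix (Fin 3) (Fin 3) K) = Matrix.diagonal ![α, β, 1]) (ρ s : ℕ) (hρ : 1 ≤ ρ) (hs : 1 ≤ s) (i : Fin 3) (ℓ : ℕ) (e : Fin 3 → K)
    (hnot : ¬ (2 ∣ s ∧ 2 * ρ ≤ min n₁ n₃ ∧ 2 * ρ + s ≤ n₂)) (hnof : ¬ (2 ∣ s ∧ n₁ = n₃ ∧ n₂ = n₁ + s ∧ n₁ < 2 * ρ ∧ 2 * ρ - n₁ ≤ n₁ - d + 1)) :
    ∑ᶠ M ∈ {M | M ∈ stratum σ ϖ T ![2 * ρ + s, 2 * ρ, 2 * ρ + s] ∧ LatticeInLevel ϖ ℓ (Matrix.diagonal e) M},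
      (kappaCount σ ϖ 0 i M : ℚ) * stabiliserWeight σ M = 0 := by
  have key := finsum_kappaCount_mul_stabiliserWeight_stratum_G2_sep_latticeInLevel_of_G1 hE hT ρ s ℓ
    (fun _ _ n₁' n₂' n₃' _ => ¬ (2 ∣ s ∧ 2 * ρ ≤ min n₂' n₃' ∧ 2 * ρ + s ≤ n₁') ∧
      ¬ (2 ∣ s ∧ n₂' = n₃' ∧ n₁' = n₂' + s ∧ n₂' < 2 * ρ ∧ 2 * ρ - n₂' ≤ n₂' - d + 1))
    (fun _ _ _ _ _ _ _ => (0 : ℚ))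
    (fun T' e' hE' hT' hHyp j => cellAny_G1_of_no_window hD h2 hE' hN₀ hT' ρ s hρ hs j ℓ e' hHyp.1 hHyp.2) e ⟨hnot, hnof⟩ i
  rw [key]

omit [CompleteSpace K] in
/-- **ANY-LABEL G3 CELL OFF THE (RESCALED) WINDOWS**: `0` — ★ p859787 rotation (datum `(α⁻¹, βα⁻¹; n₃, n₂, n₁)`). [cite: Kottwitz1986BaseChangeUnits, §1 pp. 240–241] -/
theorem cellAny_G3_of_no_window (hD : IsRamifiedQuadraticDatum σ ϖ d t) (h2 : Valued.v (2 : K) < 1) (hE : IsElementDatum σ ϖ N₀ α β n₁ n₂ n₃)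
    (hN₀ : d ≤ N₀) (hT : (T : Matrix (Fin 3) (Fin 3) K) = Matrix.diagonal ![α, β, 1]) (ρ s : ℕ) (hρ : 1 ≤ ρ) (hs : 1 ≤ s) (i : Fin 3) (ℓ : ℕ) (e : Fin 3 → K)
    (hnot : ¬ (2 ∣ s ∧ 2 * ρ ≤ min n₂ n₁ ∧ 2 * ρ + s ≤ n₃)) (hnof : ¬ (2 ∣ s ∧ n₂ = n₁ ∧ n₃ = n₂ + s ∧ n₂ < 2 * ρ ∧ 2 * ρ - n₂ ≤ n₂ - d + 1)) :
    ∑ᶠ M ∈ {M | M ∈ stratum σ ϖ T ![2 * ρ + s, 2 * ρ + s, 2 * ρ] ∧ LatticeInLevel ϖ ℓ (Matrix.diagonal e) M},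
      (kappaCount σ ϖ 0 i M : ℚ) * stabiliserWeight σ M = 0 := by
  have hvσ : ∀ a, Valued.v (σ a) = Valued.v a := hD.2.1
  have key := finsum_kappaCount_mul_stabiliserWeight_stratum_G3_sep_latticeInLevel_of_G1 hvσ hE hT ρ s ℓ
    (fun _ _ n₁' n₂' n₃' _ => ¬ (2 ∣ s ∧ 2 * ρ ≤ min n₂' n₃' ∧ 2 * ρ + s ≤ n₁') ∧
      ¬ (2 ∣ s ∧ n₂' = n₃' ∧ n₁' = n₂' + s ∧ n₂' < 2 * ρ ∧ 2 * ρ - n₂' ≤ n₂' - d + 1))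
    (fun _ _ _ _ _ _ _ => (0 : ℚ))
    (fun T' e' hE' hT' hHyp j => cellAny_G1_of_no_window hD h2 hE' hN₀ hT' ρ s hρ hs j ℓ e' hHyp.1 hHyp.2) e ⟨hnot, hnof⟩ i
  rw [key]

/-! ## §2  The G1 label condition of the square token from ∕ to exponents -/

omit [Fintype 𝓀[K]] [CompleteSpace K] in
/-- **THE G1 LABEL CONDITION FROM EXPONENT INEQUALITIES** (any vector `E` with the square token's letters: `|E₀| = |ϖ|^{2n₂}`, `|E₁| = |ϖ|^{2n₁}`, `E₂ = 0`, `|E₁ − E₀| ≤ |ϖ|^X`).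
[cite: Kottwitz1986BaseChangeUnits, §1 pp. 240–241] -/
theorem sqLabel_G1_cond_of {ϖ : K} (hϖ1 : Valued.v ϖ ≤ 1) {E : Fin 3 → K} {n₁ n₂ X ℓ ρ s : ℕ}
    (he0 : Valued.v (E 0) = Valued.v ϖ ^ (2 * n₂)) (he1 : Valued.v (E 1) = Valued.v ϖ ^ (2 * n₁)) (he2 : E 2 = 0)
    (he10 : Valued.v (E 1 - E 0) ≤ Valued.v ϖ ^ X)
    (h0 : ℓ ≤ 2 * n₂) (h1 : ℓ ≤ 2 * n₁) (h10 : ℓ + ρ ≤ X) (h21 : ℓ + ρ + s ≤ 2 * n₁) (hc1 : ℓ + 2 * ρ + s ≤ 2 * n₁) (hc2 : ℓ + 2 * ρ ≤ 2 * n₂) :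
    (Valued.v (E 0) ≤ Valued.v ϖ ^ ℓ ∧ Valued.v (E 1) ≤ Valued.v ϖ ^ ℓ ∧ Valued.v (E 2) ≤ Valued.v ϖ ^ ℓ) ∧
      Valued.v (E 1 - E 0) ≤ Valued.v ϖ ^ (ℓ + ρ) ∧ Valued.v (E 2 - E 1) ≤ Valued.v ϖ ^ (ℓ + ρ + s) ∧
        (Valued.v (E 2 - E 1) ≤ Valued.v ϖ ^ (ℓ + 2 * ρ + s) ∧ Valued.v (E 2 - E 0) * Valued.v ϖ ^ s ≤ Valued.v ϖ ^ (ℓ + 2 * ρ + s)) := by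
  have he21 : Valued.v (E 2 - E 1) = Valued.v ϖ ^ (2 * n₁) := by rw [he2, zero_sub, Valuation.map_neg, he1]
  have he20 : Valued.v (E 2 - E 0) = Valued.v ϖ ^ (2 * n₂) := by rw [he2, zero_sub, Valuation.map_neg, he0]
  refine ⟨⟨?_, ?_, ?_⟩, ?_, ?_, ?_, ?_⟩
  · rw [he0]; exact pow_le_pow_right_of_le_one' hϖ1 h0
  · rw [he1]; exact pow_le_pow_right_of_le_one' hϖ1 h1
  · rw [he2, map_zero]; exact zero_le
  · exact he10.trans (pow_le_pow_right_of_le_one' hϖ1 h10)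
  · rw [he21]; exact pow_le_pow_right_of_le_one' hϖ1 h21
  · rw [he21]; exact pow_le_pow_right_of_le_one' hϖ1 hc1
  · rw [he20, ← pow_add]; exact pow_le_pow_right_of_le_one' hϖ1 (by omega)

omit [Fintype 𝓀[K]] [CompleteSpace K] in
/-- **THE TRUNCATION READ OFF THE G1 LABEL CONDITION**: its last conjunct `|E₂ − E₀|·|ϖ|^s ≤ |ϖ|^{ℓ+2ρ+s}` with `|E₂ − E₀| = |ϖ|^{2n₂}` is `ℓ + 2ρ ≤ 2n₂`.
[cite: Kottwitz1986BaseChangeUnits, §1 pp. 240–241] -/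
theorem le_of_sqLabel_G1_cond {ϖ : K} (hϖ0 : 0 < Valued.v ϖ) (hϖlt : Valued.v ϖ < 1) {E : Fin 3 → K} {n₂ ℓ ρ s : ℕ}
    (he20 : Valued.v (E 2 - E 0) = Valued.v ϖ ^ (2 * n₂))
    (h : Valued.v (E 2 - E 0) * Valued.v ϖ ^ s ≤ Valued.v ϖ ^ (ℓ + 2 * ρ + s)) : ℓ + 2 * ρ ≤ 2 * n₂ := by
  rw [he20, ← pow_add] at h
  have := le_of_pow_le_pow hϖ0 hϖlt h
  omega

/-! ## §3  The glued cells G1 ∕ G2 of the square label in box-sum currency -/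

/-- **GLUED CELL G1 `(2ρ, 2ρ+s, 2ρ+s)` OF THE SQUARE LABEL IN BOX-SUM CURRENCY** (fence `2d ≤ nᵢ + 1`, `ℓ + 1 = d % 2 + 2d`; glue witness `f₀` of foot 0 with ★'s guard): the
labelled κ-cell equals ★ p856906's `hG1` value with the glue-foot summand cut by `2ρ + (d % 2 + 2d) ≤ 2n₂ + 1` — the `hG1` letter of `SqLabelledBoxSum` with `ω = ω(−1)`, `εG 0 ·` the
`f₀` letters.  Windows ⇒ off the class cut (★ p859941) and the indicator is read from the token letters; no window ⇒ empty stratum. [cite: Kottwitz1986BaseChangeUnits, §1 pp. 240–241]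
[cite: Rogawski1990, §4.9 Prop. 4.9.1 (a) p. 55; §4.10 p. 58] [cite: LanglandsShelstad1987, §3] -/
theorem cell_G1 (hD : IsRamifiedQuadraticDatum σ ϖ d t) (h2 : Valued.v (2 : K) < 1) (hE : IsElementDatum σ ϖ N₀ α β n₁ n₂ n₃) (hN₀ : d ≤ N₀)
    (hT : (T : Matrix (Fin 3) (Fin 3) K) = Matrix.diagonal ![α, β, 1]) (hfence : 2 * d ≤ n₁ + 1 ∧ 2 * d ≤ n₂ + 1 ∧ 2 * d ≤ n₃ + 1)
    {ℓ : ℕ} (hℓ : ℓ + 1 = d % 2 + 2 * d) (ρ s : ℕ) (hρ : 1 ≤ ρ) (hs : 1 ≤ s) (i : Fin 3) (f₀ : K) (hf₀ : σ f₀ = f₀)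
    (hglue : 2 ∣ s → n₂ = n₃ → n₁ = n₂ + s → n₂ < 2 * ρ → 2 * ρ - n₂ ≤ n₂ - d + 1 → Valued.v (f₀ + (β - 1) / (α - 1)) ≤ Valued.v ϖ ^ (2 * ρ + s - n₂)) :
    ∑ᶠ M ∈ {M | M ∈ stratum σ ϖ T ![2 * ρ, 2 * ρ + s, 2 * ρ + s] ∧
        LatticeInLevel ϖ ℓ (Matrix.diagonal ![(α - 1) * (α - 1), (β - 1) * (β - 1), 0]) M}, (kappaCount σ ϖ 0 i M : ℚ) * stabiliserWeight σ M =
      (if 2 ∣ s ∧ 2 * ρ ≤ min n₂ n₃ ∧ 2 * ρ + s ≤ n₁ then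
          (![(normSign σ (-1 : K) : ℚ) * (Fintype.card 𝓀[K] : ℚ) ^ (2 * ρ + s / 2 - 1) *
              ((if 2 * d ≤ s then (Fintype.card 𝓀[K] : ℚ) - 1 else 0) - (if s + 2 = 2 * d then 1 else 0)), 0, 0] : Fin 3 → ℚ) i
        else 0) +
      (if 2 ∣ s ∧ n₂ = n₃ ∧ n₁ = n₂ + s ∧ n₂ < 2 * ρ ∧ 2 * ρ - n₂ ≤ n₂ - d + 1 ∧ 2 * ρ + (d % 2 + 2 * d) ≤ 2 * n₂ + 1 then
          (![if 2 * d ≤ s + 2 * ((2 * ρ - n₂ + 1) / 2) then (normSign σ (-1 : K) : ℚ) * normSign σ (1 + f₀) else 0,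
             if d ≤ (2 * ρ - n₂ + 1) / 2 then (normSign σ (-1 : K) : ℚ) * normSign σ f₀ * normSign σ (1 + f₀) else 0,
             if d ≤ (2 * ρ - n₂ + 1) / 2 then (normSign σ f₀ : ℚ) else 0] : Fin 3 → ℚ) i *
            (Fintype.card 𝓀[K] : ℚ) ^ (2 * ρ + s / 2 - (2 * ρ - n₂ + 1) / 2)
        else 0) := by
  obtain ⟨-, -, hϖ, -, -, -, -⟩ := id hD
  obtain ⟨-, -, -, -, -, h₁, h₂, -, -, -, -⟩ := id hE
  have hϖ1 : Valued.v ϖ ≤ 1 := by rw [hϖ, ← WithZero.exp_zero, WithZero.exp_le_exp]; norm_num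
  have hϖ0 : 0 < Valued.v ϖ := by rw [hϖ]; exact WithZero.exp_pos
  have hϖlt : Valued.v ϖ < 1 := by rw [hϖ, ← WithZero.exp_zero, WithZero.exp_lt_exp]; norm_num
  obtain ⟨hp1, hp2, hp3⟩ := depth_mod_two_eq_of_isElementDatum hD hE hN₀
  have hiso := isoceles_of_isElementDatum hD hE
  obtain ⟨he0, he1, he2⟩ := sqToken_entries (α := α) (β := β) h₁ h₂
  obtain ⟨he20, he21, he10⟩ := sqToken_differences_le (α := α) (β := β) hϖ1 h₁ h₂
  by_cases hwin : (2 ∣ s ∧ 2 * ρ ≤ min n₂ n₃ ∧ 2 * ρ + s ≤ n₁) ∨ (2 ∣ s ∧ n₂ = n₃ ∧ n₁ = n₂ + s ∧ n₂ < 2 * ρ ∧ 2 * ρ - n₂ ≤ n₂ - d + 1)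
  · -- a window holds ⇒ off the class cut
    have hcut : ¬ (Valued.v ((![(α - 1) * (α - 1), (β - 1) * (β - 1), 0] : Fin 3 → K) 2 - (![(α - 1) * (α - 1), (β - 1) * (β - 1), 0] : Fin 3 → K) 1) =
          Valued.v ((![(α - 1) * (α - 1), (β - 1) * (β - 1), 0] : Fin 3 → K) 2 - (![(α - 1) * (α - 1), (β - 1) * (β - 1), 0] : Fin 3 → K) 0) *
            Valued.v ϖ ^ s ∧
        Valued.v ϖ ^ (ℓ + 2 * ρ + s) <
          Valued.v ((![(α - 1) * (α - 1), (β - 1) * (β - 1), 0] : Fin 3 → K) 2 - (![(α - 1) * (α - 1), (β - 1) * (β - 1), 0] : Fin 3 → K) 1)) := by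
      rintro ⟨hEq, hLt⟩
      rw [he21, he20, ← pow_add] at hEq
      rw [he21] at hLt
      have ha : 2 * n₂ + s ≤ 2 * n₁ := le_of_pow_le_pow hϖ0 hϖlt hEq.le
      have hb : 2 * n₁ ≤ 2 * n₂ + s := le_of_pow_le_pow hϖ0 hϖlt hEq.ge
      have hc : 2 * n₁ < ℓ + 2 * ρ + s := lt_of_pow_lt_pow hϖ1 hLt
      rcases hwin with ⟨-, hmin, hn1⟩ | ⟨-, h23, h1s, hlt, -⟩
      · have : 2 * ρ ≤ n₂ := le_trans hmin (min_le_left _ _)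
        omega
      · omega
    rw [finsum_kappaCount_mul_stabiliserWeight_stratum_G1_sep_latticeInLevel_of_not_cut hD h2 hE hN₀ hT ρ s hρ hs i f₀ hf₀ hglue ℓ _ hcut]
    by_cases hL : (Valued.v ((![(α - 1) * (α - 1), (β - 1) * (β - 1), 0] : Fin 3 → K) 0) ≤ Valued.v ϖ ^ ℓ ∧
          Valued.v ((![(α - 1) * (α - 1), (β - 1) * (β - 1), 0] : Fin 3 → K) 1) ≤ Valued.v ϖ ^ ℓ ∧
          Valued.v ((![(α - 1) * (α - 1), (β - 1) * (β - 1), 0] : Fin 3 → K) 2) ≤ Valued.v ϖ ^ ℓ) ∧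
        Valued.v ((![(α - 1) * (α - 1), (β - 1) * (β - 1), 0] : Fin 3 → K) 1 - (![(α - 1) * (α - 1), (β - 1) * (β - 1), 0] : Fin 3 → K) 0) ≤
            Valued.v ϖ ^ (ℓ + ρ) ∧
          Valued.v ((![(α - 1) * (α - 1), (β - 1) * (β - 1), 0] : Fin 3 → K) 2 - (![(α - 1) * (α - 1), (β - 1) * (β - 1), 0] : Fin 3 → K) 1) ≤
            Valued.v ϖ ^ (ℓ + ρ + s) ∧
          (Valued.v ((![(α - 1) * (α - 1), (β - 1) * (β - 1), 0] : Fin 3 → K) 2 - (![(α - 1) * (α - 1), (β - 1) * (β - 1), 0] : Fin 3 → K) 1) ≤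
              Valued.v ϖ ^ (ℓ + 2 * ρ + s) ∧
            Valued.v ((![(α - 1) * (α - 1), (β - 1) * (β - 1), 0] : Fin 3 → K) 2 - (![(α - 1) * (α - 1), (β - 1) * (β - 1), 0] : Fin 3 → K) 0) *
                Valued.v ϖ ^ s ≤ Valued.v ϖ ^ (ℓ + 2 * ρ + s))
    · -- label kept: the foot summand agrees because the truncation holds
      have htr : ℓ + 2 * ρ ≤ 2 * n₂ := le_of_sqLabel_G1_cond hϖ0 hϖlt he20 hL.2.2.2.2
      rw [if_pos hL]
      congr 1
      by_cases hfoot : 2 ∣ s ∧ n₂ = n₃ ∧ n₁ = n₂ + s ∧ n₂ < 2 * ρ ∧ 2 * ρ - n₂ ≤ n₂ - d + 1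
      · have h6 : 2 ∣ s ∧ n₂ = n₃ ∧ n₁ = n₂ + s ∧ n₂ < 2 * ρ ∧ 2 * ρ - n₂ ≤ n₂ - d + 1 ∧ 2 * ρ + (d % 2 + 2 * d) ≤ 2 * n₂ + 1 :=
          ⟨hfoot.1, hfoot.2.1, hfoot.2.2.1, hfoot.2.2.2.1, hfoot.2.2.2.2, by omega⟩
        rw [if_pos hfoot, if_pos h6]
      · have h6 : ¬ (2 ∣ s ∧ n₂ = n₃ ∧ n₁ = n₂ + s ∧ n₂ < 2 * ρ ∧ 2 * ρ - n₂ ≤ n₂ - d + 1 ∧ 2 * ρ + (d % 2 + 2 * d) ≤ 2 * n₂ + 1) :=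
          fun h => hfoot ⟨h.1, h.2.1, h.2.2.1, h.2.2.2.1, h.2.2.2.2.1⟩
        rw [if_neg hfoot, if_neg h6]
    · -- label fails: then no κ-mass sits on this cell
      rw [if_neg hL]
      symm
      rcases hwin with ⟨hs2, hmin, hn1⟩ | ⟨hs2, h23, h1s, hlt, hle⟩
      · have h2ρ : 2 * ρ ≤ n₂ := le_trans hmin (min_le_left _ _)
        have hnofoot : ¬ (2 ∣ s ∧ n₂ = n₃ ∧ n₁ = n₂ + s ∧ n₂ < 2 * ρ ∧ 2 * ρ - n₂ ≤ n₂ - d + 1 ∧ 2 * ρ + (d % 2 + 2 * d) ≤ 2 * n₂ + 1) :=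
          fun h => absurd h.2.2.2.1 (not_lt.2 h2ρ)
        have h3 : 2 ∣ s ∧ 2 * ρ ≤ min n₂ n₃ ∧ 2 * ρ + s ≤ n₁ := ⟨hs2, hmin, hn1⟩
        rw [if_pos h3, if_neg hnofoot, add_zero]
        by_cases hnz : i = 0 ∧ (2 * d ≤ s ∨ s + 2 = 2 * d)
        · obtain ⟨-, hsd⟩ := hnz
          exact absurd (sqLabel_G1_cond_of hϖ1 he0 he1 he2 he10 (by omega) (by omega) (by omega) (by omega) (by omega) (by omega)) hL
        · fin_cases i
          · have hnd : ¬ (2 * d ≤ s) := fun h => hnz ⟨rfl, Or.inl h⟩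
            have hne : ¬ (s + 2 = 2 * d) := fun h => hnz ⟨rfl, Or.inr h⟩
            simp only [Fin.zero_eta, Fin.isValue, Matrix.cons_val_zero, if_neg hnd, if_neg hne, sub_zero, mul_zero]
          · rfl
          · rfl
      · have hnotube : ¬ (2 ∣ s ∧ 2 * ρ ≤ min n₂ n₃ ∧ 2 * ρ + s ≤ n₁) :=
          fun h => absurd (le_trans h.2.1 (min_le_left _ _)) (not_le.2 hlt)
        have hmn : min n₁ n₂ = n₂ := min_eq_right (by omega)
        rw [hmn] at he10
        have h6 : ¬ (2 ∣ s ∧ n₂ = n₃ ∧ n₁ = n₂ + s ∧ n₂ < 2 * ρ ∧ 2 * ρ - n₂ ≤ n₂ - d + 1 ∧ 2 * ρ + (d % 2 + 2 * d) ≤ 2 * n₂ + 1) := by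
          rintro ⟨-, -, -, -, -, htr⟩
          exact hL (sqLabel_G1_cond_of hϖ1 he0 he1 he2 he10 (by omega) (by omega) (by omega) (by omega) (by omega) (by omega))
        rw [if_neg hnotube, zero_add, if_neg h6]
  · -- no window: the stratum is empty
    have hnot : ¬ (2 ∣ s ∧ 2 * ρ ≤ min n₂ n₃ ∧ 2 * ρ + s ≤ n₁) := fun h => hwin (Or.inl h)
    have hnof : ¬ (2 ∣ s ∧ n₂ = n₃ ∧ n₁ = n₂ + s ∧ n₂ < 2 * ρ ∧ 2 * ρ - n₂ ≤ n₂ - d + 1) := fun h => hwin (Or.inr h)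
    have h6 : ¬ (2 ∣ s ∧ n₂ = n₃ ∧ n₁ = n₂ + s ∧ n₂ < 2 * ρ ∧ 2 * ρ - n₂ ≤ n₂ - d + 1 ∧ 2 * ρ + (d % 2 + 2 * d) ≤ 2 * n₂ + 1) :=
      fun h => hnof ⟨h.1, h.2.1, h.2.2.1, h.2.2.2.1, h.2.2.2.2.1⟩
    rw [cellAny_G1_of_no_window hD h2 hE hN₀ hT ρ s hρ hs i ℓ _ hnot hnof, if_neg hnot, zero_add, if_neg h6]

/-- **GLUED CELL G2 `(2ρ+s, 2ρ, 2ρ+s)` OF THE SQUARE LABEL IN BOX-SUM CURRENCY** — the ★ p859787 rotation of `cell_G1` (the swap `(0 1)` carries the square token of `(α, β)` to the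
square token of `(β, α)`): ★ p856906's `hG2` value with the glue-foot summand cut by `2ρ + (d % 2 + 2d) ≤ 2n₁ + 1` (glue witness `f₁` of foot 1).
[cite: Kottwitz1986BaseChangeUnits, §1 pp. 240–241] [cite: Rogawski1990, §4.9 Prop. 4.9.1 (a) p. 55; §4.10 p. 58] [cite: LanglandsShelstad1987, §3] -/
theorem cell_G2 (hD : IsRamifiedQuadraticDatum σ ϖ d t) (h2 : Valued.v (2 : K) < 1) (hE : IsElementDatum σ ϖ N₀ α β n₁ n₂ n₃) (hN₀ : d ≤ N₀)
    (hT : (T : Matrix (Fin 3) (Fin 3) K) = Matrix.diagonal ![α, β, 1]) (hfence : 2 * d ≤ n₁ + 1 ∧ 2 * d ≤ n₂ + 1 ∧ 2 * d ≤ n₃ + 1)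
    {ℓ : ℕ} (hℓ : ℓ + 1 = d % 2 + 2 * d) (ρ s : ℕ) (hρ : 1 ≤ ρ) (hs : 1 ≤ s) (i : Fin 3) (f₁ : K) (hf₁ : σ f₁ = f₁)
    (hglue : 2 ∣ s → n₁ = n₃ → n₂ = n₁ + s → n₁ < 2 * ρ → 2 * ρ - n₁ ≤ n₁ - d + 1 → Valued.v (f₁ + (α - 1) / (β - 1)) ≤ Valued.v ϖ ^ (2 * ρ + s - n₁)) :
    ∑ᶠ M ∈ {M | M ∈ stratum σ ϖ T ![2 * ρ + s, 2 * ρ, 2 * ρ + s] ∧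
        LatticeInLevel ϖ ℓ (Matrix.diagonal ![(α - 1) * (α - 1), (β - 1) * (β - 1), 0]) M}, (kappaCount σ ϖ 0 i M : ℚ) * stabiliserWeight σ M =
      (if 2 ∣ s ∧ 2 * ρ ≤ min n₁ n₃ ∧ 2 * ρ + s ≤ n₂ then
          (![0, (normSign σ (-1 : K) : ℚ) * (Fintype.card 𝓀[K] : ℚ) ^ (2 * ρ + s / 2 - 1) *
              ((if 2 * d ≤ s then (Fintype.card 𝓀[K] : ℚ) - 1 else 0) - (if s + 2 = 2 * d then 1 else 0)), 0] : Fin 3 → ℚ) i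
        else 0) +
      (if 2 ∣ s ∧ n₁ = n₃ ∧ n₂ = n₁ + s ∧ n₁ < 2 * ρ ∧ 2 * ρ - n₁ ≤ n₁ - d + 1 ∧ 2 * ρ + (d % 2 + 2 * d) ≤ 2 * n₁ + 1 then
          (![if d ≤ (2 * ρ - n₁ + 1) / 2 then (normSign σ (-1 : K) : ℚ) * normSign σ f₁ * normSign σ (1 + f₁) else 0,
             if 2 * d ≤ s + 2 * ((2 * ρ - n₁ + 1) / 2) then (normSign σ (-1 : K) : ℚ) * normSign σ (1 + f₁) else 0,
             if d ≤ (2 * ρ - n₁ + 1) / 2 then (normSign σ f₁ : ℚ) else 0] : Fin 3 → ℚ) i *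
            (Fintype.card 𝓀[K] : ℚ) ^ (2 * ρ + s / 2 - (2 * ρ - n₁ + 1) / 2)
        else 0) := by
  have key := finsum_kappaCount_mul_stabiliserWeight_stratum_G2_sep_latticeInLevel_of_G1 hE hT ρ s ℓ
    (fun α' β' n₁' n₂' n₃' e' => e' = ![(α' - 1) * (α' - 1), (β' - 1) * (β' - 1), 0] ∧ (2 * d ≤ n₁' + 1 ∧ 2 * d ≤ n₂' + 1 ∧ 2 * d ≤ n₃' + 1) ∧
      (2 ∣ s → n₂' = n₃' → n₁' = n₂' + s → n₂' < 2 * ρ → 2 * ρ - n₂' ≤ n₂' - d + 1 →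
        Valued.v (f₁ + (β' - 1) / (α' - 1)) ≤ Valued.v ϖ ^ (2 * ρ + s - n₂')))
    (fun _ _ n₁' n₂' n₃' _ j =>
      (if 2 ∣ s ∧ 2 * ρ ≤ min n₂' n₃' ∧ 2 * ρ + s ≤ n₁' then
          (![(normSign σ (-1 : K) : ℚ) * (Fintype.card 𝓀[K] : ℚ) ^ (2 * ρ + s / 2 - 1) *
              ((if 2 * d ≤ s then (Fintype.card 𝓀[K] : ℚ) - 1 else 0) - (if s + 2 = 2 * d then 1 else 0)), 0, 0] : Fin 3 → ℚ) j
        else 0) +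
      (if 2 ∣ s ∧ n₂' = n₃' ∧ n₁' = n₂' + s ∧ n₂' < 2 * ρ ∧ 2 * ρ - n₂' ≤ n₂' - d + 1 ∧ 2 * ρ + (d % 2 + 2 * d) ≤ 2 * n₂' + 1 then
          (![if 2 * d ≤ s + 2 * ((2 * ρ - n₂' + 1) / 2) then (normSign σ (-1 : K) : ℚ) * normSign σ (1 + f₁) else 0,
             if d ≤ (2 * ρ - n₂' + 1) / 2 then (normSign σ (-1 : K) : ℚ) * normSign σ f₁ * normSign σ (1 + f₁) else 0,
             if d ≤ (2 * ρ - n₂' + 1) / 2 then (normSign σ f₁ : ℚ) else 0] : Fin 3 → ℚ) j *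
            (Fintype.card 𝓀[K] : ℚ) ^ (2 * ρ + s / 2 - (2 * ρ - n₂' + 1) / 2)
        else 0))
    (fun T' e' hE' hT' hHyp j => by
      obtain ⟨he', hf', hg'⟩ := hHyp
      rw [he']
      exact cell_G1 hD h2 hE' hN₀ hT' hf' hℓ ρ s hρ hs j f₁ hf₁ hg')
    ![(α - 1) * (α - 1), (β - 1) * (β - 1), 0] ⟨by ext j; fin_cases j <;> rfl, ⟨hfence.2.1, hfence.1, hfence.2.2⟩, hglue⟩ i
  rw [key]
  simp only [vec3_swap01]

end Summit.HodgeConjecture.HodgeConjecture.Cruxes.H413.F0P3cDyRamSqLabelledCellsGlued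

end
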